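import Summits.Schanuel.Schanuel.Theorems.RootDecomp1HGauge

/-!
# RootDecomp1H — ROUND 10 «CYCLIC CELLS», part 1 of 5 (§1 exponential 3-cycles; §2a closure lemmas)

All parts (`RootDecomp1HCyclesCore` §1+§2a, `RootDecomp1HCyclesRigid` §2b, `RootDecomp1HCyclesCell` §3–§4, `RootDecomp1HCyclesInstrument` §5,
`RootDecomp1HCycles` §6–§8) share the namespace `Summit.Schanuel.Schanuel.Theorems.RootDecomp1HCycles`; importers use `RootDecomp1HCycles`. lens-5 g10 (port rev d ac33957a); `--supports stmt-Schanuel-30564`.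

# RootDecomp1H — ROUND 10 «CYCLIC CELLS»: the residual's own first cell, made a theorem-certified inhabited sub-cell of the
# instrument's cheapest cell `(3, 1)`

lens-5 cell decomp-schanuel, generation 10; `--supports stmt-Schanuel-30564` (residual `BridgeTransverse`) and
`stmt-Schanuel-27287` (instrument `FinCS`).  Imports only the landed `RootDecomp1HGauge` (p770410).

## The objects

An EXPONENTIAL 3-CYCLE with rational parameters `(r, c)`, `r_j ≠ 0`, is a point `y = (y₀, y₁, y₂) ∈ ℂ³` with
`y_{j+1} = r_j · e^{y_j} + c_j` (`j ∈ ℤ/3`).  Writing `u_j = e^{y_j}` one has `ℚ(y, e^y) = ℚ(u₀, u₁, u₂)`, so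
`trdeg ℚ(y, e^y) ≤ 3 = n`: every `ℚ`-free 3-cycle sits exactly AT Schanuel's bound — the «conjugation-stable exponential
3-cycles outside every tower span» that the docstring of the residual `BridgeTransverse` names as its first cells at risk, and
item (b) of the critic's convergence watch.  A UNIT cycle has `r_j = ±1`, `c_j ∈ {−1, 0, 1}`; a REAL one has `y ∈ ℝ³`.

## What is proved (0 sorry; hypotheses named in each statement)

§2 RIGIDITY (pure algebra, no hypothesis): along every non-zero direction `v ∈ span_ℚ y` of a 3-cycle, the whole configuration
   `(y, e^y)` is algebraic over `ℚ(v, e^v)` and ONE further number (`rigid_cycle : Rigid y 1`).  Mechanism: if `M v = Σ p_j y_j`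
   (`p ∈ ℤ³ ∖ 0`) then `Σ_j p_{j+1} r_j u_j = M v − Σ p_{j+1} c_j` is LINEAR in `u` and `Π u_j^{p_j} = (e^v)^M` is a MONOMIAL; one
   budget coordinate `u_k` and the two-variable elimination `mem_closure_of_pair` (`α e + β f = A`, `e^m f^n = B`, `m + n ≠ 0`)
   finish.  Consequence: every curve-closed subspace containing a non-zero vector of `span_ℚ y` contains `y`
   (`selfAbsorbing_cycle`, via the absorption-of-one-storey lemma of round 8).
§3 TRANSVERSALITY (hypothesis `SchanuelOn 𝓚` ⟺ `ProductSchanuel ∧ RelTowerSchanuel`, the route's structural binders): a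
   `ℚ`-free 3-cycle meets the span of every `ℚ`-free tower tuple trivially, hence lies OFF THE TOWER HULL
   (`not_inTowerHull_cycle`) — by round 8's `inf_towerSpan_eq_bot` with budget `1 ≤ n − 2`.
§4 THE CELL (no hypothesis): a real unit 3-cycle in the sup-ball `‖y‖ ≤ 4` with `y₀ + y₁ + y₂ ≠ 0` is PRESENTED AT SIZE 1
   (system `X_{j+1} − r_j Y_j − c_j`, exponential Jacobian `1 − r₀ r₁ r₂ e^{y₀+y₁+y₂}`), hence NEAR-`c⋆`-OPTIMAL with `c⋆ = 1`
   (`nearOpt_of_presented_one`: nothing is presented at size 0), and CONJUGATION-STABLE: it inhabits cell `(3, 1)` of the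
   instrument `FinCS` and — when `ℚ`-free, a counterexample, and off the hull — the domain of the residual `BridgeTransverse`.
§5 THE INSTRUMENT AT A CYCLE (no hypothesis): under the cyclic substitution `X_{j+1} ↦ r_j U_j + c_j, Y_j ↦ U_j` every integer
   polynomial vanishing at `(y, e^y)` whose image is `0` has its gradient in the 3-plane spanned by the gradients of the cycle
   equations (`grad_mem_of_cycSubst_eq_zero`, Leibniz induction); so FOUR such polynomials never have independent gradients, and the
   instrument instance `FinCSAt g` at `(3, 1, y)` follows from the EXCLUSION `SrcExcl N`: «no integer polynomial of size ≤ N has a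
   non-zero cyclic image vanishing at `u = e^y`» (`no_certificate_of_srcExcl`, `finCS_cell_of_srcExcl`) — a finite, certified
   lattice computation per point (images have total degree ≤ N, `totalDegree_cycSubst_le`, and height ≤ 13 440 for N = 4 and
   unit parameters; census request K10).  At such a point the residual reads EXACTLY «`LowerRanks 3 →` `y` is not a
   counterexample», i.e. `trdeg ℚ(e^{y₀}, e^{y₁}, e^{y₂}) = 3` (`bridge_cell_iff`, `adjoin_cycle_eq`).
§6 HEIGHTS (no hypothesis): the `ℓ¹`-norm on `MvPolynomial σ ℤ` is subadditive and submultiplicative (`l1_add_le`,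
   `l1_mul_le`), so the cyclic image of a size-`≤ 4` polynomial has height `≤ 10⁶` (`height_cycSubst_le`; crude constant, the
   sharp one is 13 440); hence the census's IMAGE certificate «no non-zero `G ∈ ℤ[U]` of degree `≤ 4` and height `≤ H` vanishes
   at `u`», `H ≥ 10⁶` (`ImgExcl u 4 H`; CYCLES31-v1 certifies `H ≥ 10^{12.5}` at all 105 `ℚ`-free real unit 3-cycles in the
   ball) implies `SrcExcl 4` (`srcExcl_of_imgExcl`) and the LIVE instrument instance `FinCSAt stdGauge` at `(3, 1, y)`
   (`finCS_cell_of_imgExcl`), with the residual's exact reading there (`bridge_cell_iff_of_imgExcl`).  The reduction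
   «certificate ⟹ instrument instance» is thus kernel-checked end to end; only the certificate itself is external (Arb/FLINT).

§7 NODE: `node_closes` CALLS the live `RootDecomp1H.closes` (rev 14) verbatim; `cell_node` assembles §3–§6 at a certified real unit
   3-cycle: the instrument binder `h₂` holds there outright, and under `h₃ h₄` the point is in the residual's domain where `h₅`
   reads «`LowerRanks 3 → ¬ CounterEx`».

§8 INHABITED (kernel, no census): by the intermediate value theorem the class `ε = (−1,−1,−1)`, `c = (−1,−1,0)` has a real
   3-cycle in the ball with `Σ t < 0` (`exists_realUnitCycle`), so cell `(3, 1)` of the instrument CONTAINS an exponential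
   3-cycle: `cell_inhabited : ∃ y, IsIntCycle εOne cOne y ∧ NearOpt 3 1 y ∧ ConjStable y ∧ (real) ∧ (PS → RTS → ℚ-free → ¬ InTowerHull y)`.

Nothing here proves Schanuel's conjecture or the residual; rung 0.
-/

set_option linter.dupNamespace false

noncomputable section

namespace Summit.Schanuel.Schanuel.Theorems.RootDecomp1HCycles

open Complex Set
open Literature.NumberTheory.Transcendental (exists_nsmul_mem_span_int mem_adjoin_of_mem_span_int SchanuelRank Khovanskii.ePD)
open Summit.Schanuel.Schanuel.Theses.RootDecomp1H (ProductSchanuel RelTowerSchanuel BridgeTransverse FinCS)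
open Summit.Schanuel.Schanuel.Theorems.RootDecomp1HTowerCells (trdeg_adjoin_adjoin_eq trdeg_adjoin_union_le
  trdeg_adjoin_range_le)
open Summit.Schanuel.Schanuel.Theorems.RootDecomp1HCurveHull
open Summit.Schanuel.Schanuel.Theorems.RootDecomp1HClearance (LowerRanks CounterEx InTowerHull)
open Summit.Schanuel.Schanuel.Theorems.RootDecomp1HWitness
open Summit.Schanuel.Schanuel.Theorems.RootDecomp1HGauge

/-! ## 1. Exponential 3-cycles -/

/-- `y` is an EXPONENTIAL 3-CYCLE with rational parameters `(r, c)`: `r_j ≠ 0` and `y_{j+1} = r_j e^{y_j} + c_j` (`j ∈ ℤ/3`). -/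
def IsCycle (r c : Fin 3 → ℚ) (y : Fin 3 → ℂ) : Prop :=
  (∀ j, r j ≠ 0) ∧ ∀ j, y (j + 1) = r j * cexp (y j) + c j

/-- `(0 : Fin 3) + 1 = 1`. -/
@[simp] private theorem fin3_zero_add_one : (0 : Fin 3) + 1 = 1 := rfl
/-- `(1 : Fin 3) + 1 = 2`. -/
@[simp] private theorem fin3_one_add_one : (1 : Fin 3) + 1 = 2 := rfl
/-- `(2 : Fin 3) + 1 = 0`. -/
@[simp] private theorem fin3_two_add_one : (2 : Fin 3) + 1 = 0 := rfl
/-- `(0 : Fin 3) - 1 = 2`. -/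
@[simp] theorem fin3_zero_sub_one : (0 : Fin 3) - 1 = 2 := rfl
/-- `(1 : Fin 3) - 1 = 0`. -/
@[simp] theorem fin3_one_sub_one : (1 : Fin 3) - 1 = 0 := rfl
/-- `(2 : Fin 3) - 1 = 1`. -/
@[simp] theorem fin3_two_sub_one : (2 : Fin 3) - 1 = 1 := rfl

/-- Rational numbers lie in every intermediate field. -/
theorem ratCast_mem (K : IntermediateField ℚ ℂ) (q : ℚ) : (q : ℂ) ∈ K := by
  have h := K.algebraMap_mem q
  rwa [eq_ratCast] at h

namespace IsCycle

variable {r c : Fin 3 → ℚ} {y : Fin 3 → ℂ}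

/-- `(r j : ℂ) ≠ 0`. -/
theorem r_ne (h : IsCycle r c y) (j : Fin 3) : (r j : ℂ) ≠ 0 := Rat.cast_ne_zero.2 (h.1 j)

/-- `y (j + 1) = r j * cexp (y j) + c j`. -/
theorem succ_eq (h : IsCycle r c y) (j : Fin 3) : y (j + 1) = r j * cexp (y j) + c j := h.2 j

/-- Every coordinate is an affine image of the previous exponential: `y_j = r_{j−1} e^{y_{j−1}} + c_{j−1}`. -/
theorem self_eq (h : IsCycle r c y) (j : Fin 3) : y j = r (j - 1) * cexp (y (j - 1)) + c (j - 1) := by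
  have := h.2 (j - 1); rwa [sub_add_cancel] at this

/-- `e^{y_j} = (y_{j+1} − c_j) / r_j`. -/
theorem exp_eq (h : IsCycle r c y) (j : Fin 3) : cexp (y j) = (y (j + 1) - c j) / r j := by
  rw [h.succ_eq j]; field_simp [h.r_ne j]; ring

/-- `ℚ(y, e^y) = ℚ(e^{y₀}, e^{y₁}, e^{y₂})`. -/
theorem adjoin_cycle_eq (h : IsCycle r c y) :
    IntermediateField.adjoin ℚ (range y ∪ range (cexp ∘ y)) = IntermediateField.adjoin ℚ (range (cexp ∘ y)) := by
  refine le_antisymm (IntermediateField.adjoin_le_iff.2 ?_) (IntermediateField.adjoin.mono _ _ _ subset_union_right)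
  rintro w (⟨j, rfl⟩ | ⟨j, rfl⟩)
  · rw [SetLike.mem_coe, h.self_eq j]
    exact add_mem (mul_mem (ratCast_mem _ _) (IntermediateField.subset_adjoin _ _ ⟨j - 1, rfl⟩)) (ratCast_mem _ _)
  · exact IntermediateField.subset_adjoin _ _ ⟨j, rfl⟩

end IsCycle

/-! ## 2. Rigidity with budget one and self-absorption (pure algebra) -/

section closure

variable (K : IntermediateField ℚ ℂ)

/-- The algebraic closure of `K` in `ℂ` is algebraically closed in `ℂ`: numbers algebraic over it lie in it. -/
theorem mem_closure_of_isAlgebraic_closure {z : ℂ} (hz : IsAlgebraic (algebraicClosure K ℂ) z) :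
    z ∈ algebraicClosure K ℂ :=
  mem_algebraicClosure_iff'.2 (isIntegral_trans z hz.isIntegral)

/-- ONE-SIDED TWO-VARIABLE ELIMINATION: from `α e + β f = A` and `e^k f^n = B` over `L = K̄ ∩ ℂ` with `k > 0`, `n ≠ 0`,
`k + n ≠ 0`, `α β e f ≠ 0`, the number `e` is algebraic over `L`, hence in `L`. -/
theorem mem_closure_of_pair_aux {α β A B e f : ℂ} {k : ℕ} {n : ℤ} (hk : 0 < k) (hn : n ≠ 0) (hkn : (k : ℤ) + n ≠ 0)
    (hβ : β ≠ 0) (he : e ≠ 0) (hf : f ≠ 0)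
    (hαL : α ∈ algebraicClosure K ℂ) (hβL : β ∈ algebraicClosure K ℂ) (hAL : A ∈ algebraicClosure K ℂ)
    (hBL : B ∈ algebraicClosure K ℂ) (hlin : α * e + β * f = A) (hmon : e ^ (k : ℤ) * f ^ n = B) :
    e ∈ algebraicClosure K ℂ := by
  have hAf : A - α * e = β * f := by rw [← hlin]; ring
  have hB0 : B ≠ 0 := by rw [← hmon]; exact mul_ne_zero (zpow_ne_zero _ he) (zpow_ne_zero _ hf)
  apply mem_closure_of_isAlgebraic_closure K
  let a : ↥(algebraicClosure K ℂ) := ⟨α, hαL⟩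
  let b : ↥(algebraicClosure K ℂ) := ⟨β, hβL⟩
  let A' : ↥(algebraicClosure K ℂ) := ⟨A, hAL⟩
  let B' : ↥(algebraicClosure K ℂ) := ⟨B, hBL⟩
  have ha : algebraMap (algebraicClosure K ℂ) ℂ a = α := rfl
  have hb : algebraMap (algebraicClosure K ℂ) ℂ b = β := rfl
  have hA' : algebraMap (algebraicClosure K ℂ) ℂ A' = A := rfl
  have hB' : algebraMap (algebraicClosure K ℂ) ℂ B' = B := rfl
  have hb0 : b ≠ 0 := fun h => hβ (by rw [← hb, h, map_zero])
  have hB'0 : B' ≠ 0 := fun h => hB0 (by rw [← hB', h, map_zero])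
  rcases Int.eq_nat_or_neg n with ⟨l, rfl | rfl⟩
  · -- `n = l > 0`:  `e^k (A − α e)^l = B β^l`
    rw [zpow_natCast, zpow_natCast] at hmon
    have key : e ^ k * (A - α * e) ^ l - B * β ^ l = 0 := by
      rw [hAf, mul_pow, ← hmon]; ring
    refine ⟨Polynomial.X ^ k * (Polynomial.C A' - Polynomial.C a * Polynomial.X) ^ l - Polynomial.C (B' * b ^ l), ?_, ?_⟩
    · intro h0
      have := congrArg (Polynomial.eval 0) h0
      simp only [Polynomial.eval_sub, Polynomial.eval_mul, Polynomial.eval_pow, Polynomial.eval_X, Polynomial.eval_C,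
        zero_pow hk.ne', zero_mul, mul_zero, sub_zero, zero_sub, Polynomial.eval_zero, neg_eq_zero, mul_eq_zero,
        pow_eq_zero_iff', ne_eq] at this
      rcases this with h | ⟨h, -⟩
      · exact hB'0 h
      · exact hb0 h
    · have := key
      simp only [map_sub, map_mul, map_pow, Polynomial.aeval_X, Polynomial.aeval_C]
      exact this
  · -- `n = −l < 0`:  `β^l e^k = B (A − α e)^l`
    have hkl : k ≠ l := fun h => hkn (by subst h; simp)
    rw [zpow_natCast, zpow_neg, zpow_natCast, mul_inv_eq_iff_eq_mul₀ (pow_ne_zero _ hf)] at hmon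
    have key : β ^ l * e ^ k - B * (A - α * e) ^ l = 0 := by
      rw [hAf, mul_pow, hmon]; ring
    refine ⟨Polynomial.C (b ^ l) * Polynomial.X ^ k - Polynomial.C B' * (Polynomial.C A' - Polynomial.C a * Polynomial.X) ^ l,
      ?_, ?_⟩
    · intro h0
      by_cases hA0 : A = 0
      · have hA'0 : A' = 0 := Subtype.ext hA0
        have hpoly : (Polynomial.C A' - Polynomial.C a * Polynomial.X) ^ l = Polynomial.C ((-a) ^ l) * Polynomial.X ^ l := by
          rw [hA'0, map_zero, zero_sub, neg_mul_eq_neg_mul, ← Polynomial.C_neg, mul_pow, ← Polynomial.C_pow]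
        rw [hpoly] at h0
        have := congrArg (fun P => Polynomial.coeff P k) h0
        simp only [Polynomial.coeff_sub, Polynomial.coeff_C_mul, Polynomial.coeff_X_pow, if_true,
          hkl, if_false, mul_one, mul_zero, sub_zero, Polynomial.coeff_zero] at this
        exact pow_ne_zero l hb0 this
      · have hA'0 : A' ≠ 0 := fun h => hA0 (by rw [← hA', h, map_zero])
        have := congrArg (Polynomial.eval 0) h0
        simp only [Polynomial.eval_sub, Polynomial.eval_mul, Polynomial.eval_pow, Polynomial.eval_X, Polynomial.eval_C,
          zero_pow hk.ne', mul_zero, sub_zero, zero_sub, Polynomial.eval_zero, neg_eq_zero, mul_eq_zero,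
          pow_eq_zero_iff', ne_eq] at this
        rcases this with h | ⟨h, -⟩
        · exact hB'0 h
        · exact hA'0 h
    · have := key
      simp only [map_sub, map_mul, map_pow, Polynomial.aeval_X, Polynomial.aeval_C]
      exact this

/-- **TWO-VARIABLE ELIMINATION.**  If `α e + β f = A` and `e^m f^n = B` with `α, β, A, B ∈ L = K̄ ∩ ℂ`, `α β e f ≠ 0`,
`m, n ≠ 0` and `m + n ≠ 0`, then `e, f ∈ L`.  (The excluded case `m + n = 0` is a genuine exception: `e/f = B`, `α e + β f = A`
has a one-parameter family of solutions when `A = 0`, `α + β B⁻¹… = 0`.) -/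
theorem mem_closure_of_pair {α β A B e f : ℂ} {m n : ℤ} (hm : m ≠ 0) (hn : n ≠ 0) (hmn : m + n ≠ 0)
    (hα : α ≠ 0) (hβ : β ≠ 0) (he : e ≠ 0) (hf : f ≠ 0)
    (hαL : α ∈ algebraicClosure K ℂ) (hβL : β ∈ algebraicClosure K ℂ) (hAL : A ∈ algebraicClosure K ℂ)
    (hBL : B ∈ algebraicClosure K ℂ) (hlin : α * e + β * f = A) (hmon : e ^ m * f ^ n = B) :
    e ∈ algebraicClosure K ℂ ∧ f ∈ algebraicClosure K ℂ := by
  -- it suffices to get ONE of the two; the other is then affine in it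
  have back_f : e ∈ algebraicClosure K ℂ → f ∈ algebraicClosure K ℂ := fun heL => by
    have : f = (A - α * e) / β := by rw [← hlin]; field_simp; ring
    rw [this]; exact div_mem (sub_mem hAL (mul_mem hαL heL)) hβL
  have back_e : f ∈ algebraicClosure K ℂ → e ∈ algebraicClosure K ℂ := fun hfL => by
    have : e = (A - β * f) / α := by rw [← hlin]; field_simp; ring
    rw [this]; exact div_mem (sub_mem hAL (mul_mem hβL hfL)) hαL
  rcases Int.eq_nat_or_neg m with ⟨k, rfl | rfl⟩
  · have hk : 0 < k := Nat.pos_of_ne_zero (by exact_mod_cast hm)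
    have heL := mem_closure_of_pair_aux K hk hn hmn hβ he hf hαL hβL hAL hBL hlin hmon
    exact ⟨heL, back_f heL⟩
  · have hk : 0 < k := Nat.pos_of_ne_zero (fun h => hm (by simp [h]))
    rcases Int.eq_nat_or_neg n with ⟨l, rfl | rfl⟩
    · have hl : 0 < l := Nat.pos_of_ne_zero (by exact_mod_cast hn)
      have hfL := mem_closure_of_pair_aux K (k := l) (n := -k) hl hm (by omega) hα hf he hβL hαL hAL hBL
        (by rw [add_comm]; exact hlin) (by rw [mul_comm]; exact hmon)
      exact ⟨back_e hfL, hfL⟩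
    · have hl : 0 < l := Nat.pos_of_ne_zero (fun h => hn (by simp [h]))
      have hmon' : e ^ (k : ℤ) * f ^ (l : ℤ) = B⁻¹ := by
        rw [← hmon, zpow_neg, zpow_neg, mul_inv]; simp
      have heL := mem_closure_of_pair_aux K (k := k) (n := l) hk (by exact_mod_cast hl.ne') (by omega) hβ he hf hαL hβL
        hAL (inv_mem hBL) hlin hmon'
      exact ⟨heL, back_f heL⟩

end closure

end Summit.Schanuel.Schanuel.Theorems.RootDecomp1HCycles
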